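import Mathlib
import HarnessLib
import Summits.Ventures.LatticeQCDFlow.Exactness.SphereLOFlowEntropyFloorPairs
import Summits.Ventures.LatticeQCDFlow.Exactness.SphereLOCarrePairConditionalVariance
import Summits.Ventures.LatticeQCDFlow.Exactness.EntropyFloorBlockTermSmallTime

/-!
# The explicit extensive floor: `KL((Φ_{0→c})_*π̄ ‖ e^{−cS}π̄/Z_c) ≥ Σ_j log(1 + (max 0 ((c⁴/8)·n_j·32κ⁴β₀⁴/((d−1)d²(d+2)) − 4ρ_j²))/(2 + M_j)) − |Λ|·(12κ²υ²/(d−1))·c²·τ_m(c)` for blocks carrying `n_j` disjoint coupled pairs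

HONEST FRAMING: exact (Metropolis-corrected) sampling algorithms for lattice gauge theory;
figures of merit are autocorrelation/cost numbers at stated couplings and volumes; no
continuum-physics claim.

Venture `LatticeQCDFlow` (cell pub-lqcd), topic `Exactness`; FANOUT row 7 (`s0-cpn-null`).  NEW WORK
of the cell over this lineage's `Exactness/SphereLOFlowEntropyFloorPairs.lean` (the extensive floor of
the reverse relative entropy of the exact leading-order flow sampler in terms of conditional variances of
the static block terms given disjoint groups of spins) and
`Exactness/SphereLOCarrePairConditionalVariance.lean` (for a coupled pair without a common neighbour
inside the block that conditional variance is `32κ⁴β_{kl}⁴/((d−1)d²(d+2))`); nothing is cited as a fact.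
Printed counterparts, NAMED ONLY: Engel–Schaefer, Comput. Phys. Commun. 182 (2011) 2107, §3 (the LO
trivializing map of the CP(N−1) model inside HMC); M. Lüscher, Commun. Math. Phys. 293 (2010) 899,
§3–§4; Abbott et al., Phys. Rev. D 106 (2022) 074506, §V (for fixed models the quality of flow
samplers degrades exponentially in the volume) — here a THEOREM for the exact leading-order flow: THE
FULLY EXPLICIT FORM OF THE BARRIER.  For the E–S action with no self-coupling, adjoint pairs and
scaled-isometric links (`‖U_{nm}v‖ = β_{nm}‖v‖`; CP(N−1): unitary links, `d = 2N`), any family of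
blocks `B_j` separated for the radius-`(m+1)` balls, and in each block any `n_j` pairwise disjoint
COUPLED PAIRS `{k,l} ⊆ B_j` with a common link weight `β_{kl} = β₀` and no common neighbour
(triangle-free — every nearest-neighbour pair of `ℤ²`):
`KL((Φ_{0→c})_*π̄ ‖ e^{−cS}π̄/Z_c) ≥ Σ_j log(1 + (max 0 ((c⁴/8)·n_j·32κ⁴β₀⁴/((d−1)d²(d+2)) − 4ρ_j²))/(2 + M_j))
 − |Λ|·(12κ²υ²/(d−1))·c²·τ_m(c)`, `ρ_j = |I_j|(4|κ|³υ³/(d−1)²)c³`, `M_j = 2|I_j|(κ²υ²/(d−1))c²`,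
`τ_m(c) = 2e^{Kc}(Kc)^{m+1}/(m+1)!`, `K = 3|κ|υ/(d−1)`: every block term is an explicit function of
`(c, κ, β₀, υ, d, |I_j|, n_j)` alone, positive for `0 < c < c₀(κ, β₀, υ, d, |I_j|)` with `n_j ≥ 1`, so for
congruent blocks the floor is (number of blocks)·(a positive constant of order `c⁴`) minus
|Λ|·O(c^{m+3}) — LINEAR IN THE VOLUME at fixed flow time.

## Content

* **`sum_log_one_add_explicit_sub_le_klDiv_map_loFlow`** — the displayed inequality.

NOT CLAIMED: the choice of blocks / pairs for a specific lattice (e.g. the count of separated boxes in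
an `L × L` torus) and the resulting numerical rate; the small-`c` positivity threshold `c₀` in closed
form; pairs with a common neighbour; anything about ESS, acceptance or autocorrelations of the
Metropolis-corrected chain (the floor concerns the reverse relative entropy — the training objective);
numbers.

## Part II (merged here from the staged file `SphereLOFlowEntropyFloorSmallTime.lean`, same lineage)

### The extensive floor at small flow time: `KL((Φ_{0→c})_*π̄ ‖ e^{−cS}π̄/Z_c) ≥ |T_b|·n₀·κ⁴β₀⁴c⁴/(4(d−1)d²(d+2)) − |Λ|·(12κ²υ²/(d−1))·c²·τ_m(c)` — LINEAR IN THE NUMBER OF BLOCKS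

HONEST FRAMING: exact (Metropolis-corrected) sampling algorithms for lattice gauge theory;
figures of merit are autocorrelation/cost numbers at stated couplings and volumes; no
continuum-physics claim.

Venture `LatticeQCDFlow` (cell pub-lqcd), topic `Exactness`; FANOUT row 7 (`s0-cpn-null`).  NEW WORK
of the cell over Part I of this file (the explicit
extensive floor, block by block) and `Exactness/EntropyFloorBlockTermSmallTime.lean` (the small-time
floor `n·A·c⁴/128` of one block term and its sum over blocks); nothing is cited as a fact.  Printed
counterparts, NAMED ONLY: Engel–Schaefer, Comput. Phys. Commun. 182 (2011) 2107, §3; M. Lüscher,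
Commun. Math. Phys. 293 (2010) 899, §3–§4; Abbott et al., Phys. Rev. D 106 (2022) 074506, §V.  THE
BARRIER, STATED AS ONE INEQUALITY: for the E–S / CP(N−1) action (no self-coupling, adjoint pairs,
scaled-isometric links, `Σ_m‖U_{nm}‖ ≤ υ`), the exact leading-order trivializing flow `Φ_{0→c}`, ANY
family `T_b` of blocks separated for the radius-`(m+1)` balls, each carrying at least `n₀` pairwise
disjoint coupled pairs of link weight `β₀` without a common neighbour and having at most `I₀` sites in
its cone neighbourhood, and every flow time `0 ≤ c ≤ |T| + 1` satisfying the three explicit smallness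
conditions `4I₀²ρ²c² ≤ n₀A/16`, `I₀μc² ≤ 1`, `n₀Ac⁴ ≤ 64` (`A = 32κ⁴β₀⁴/((d−1)d²(d+2))`,
`ρ = 4|κ|³υ³/(d−1)²`, `μ = κ²υ²/(d−1)` — conditions on `c` that do not see the volume):
`KL((Φ_{0→c})_*π̄ ‖ e^{−cS}π̄/Z_c) ≥ |T_b|·n₀·A·c⁴/128 − |Λ|·12μc²·2e^{Kc}(Kc)^{m+1}/(m+1)!`,
`K = 3|κ|υ/(d−1)`.  For congruent blocks tiling a fixed fraction of an `L × L` torus, `|T_b| ∝ |Λ|`: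
at fixed small flow time the reverse relative entropy of the exact LO flow sampler — the training
objective, `≤ |Λ|D²/8` by this lineage's ceiling — is ALSO bounded below by a positive constant times
the volume, the cone tail being of higher order `c^{m+3}` for `m ≥ 2`.

## Content

* **`card_mul_pow_four_sub_le_klDiv_map_loFlow`** — the displayed inequality.

NOT CLAIMED: the block count of a specific lattice (torus tilings are not formalized here); the
comparison of the `c⁴` term with the `c^{m+3}` tail as a single threshold; ESS / acceptance ceilings
or autocorrelations of the Metropolis-corrected chain; numbers.
-/

noncomputable section

namespace Summit.Ventures.LatticeQCDFlow.Exactness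

open Function Set Metric MeasureTheory NormedSpace InnerProductSpace InformationTheory
open scoped RealInnerProductSpace Topology Nat Classical

variable {Λ : Type*} {E : Type*} [NormedAddCommGroup E] [InnerProductSpace ℝ E]
  [FiniteDimensional ℝ E] [Fintype Λ] [DecidableEq Λ]

section Explicit

variable [MeasurableSpace E] [BorelSpace E] [Nontrivial E] {U : Λ → Λ → (E →L[ℝ] E)} {T : ℝ}

/-- **THE EXPLICIT EXTENSIVE FLOOR FOR THE REVERSE RELATIVE ENTROPY OF THE EXACT LEADING-ORDER FLOW
SAMPLER.**  E–S couplings with no self-coupling, adjoint pairs and scaled-isometric links; blocks `B_j`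
(`j ∈ T_b`) pairwise disjoint and separated for the radius-`(m+1)` balls of `N n = {n} ∪ couplingNbhd U n`;
in each block a family `Pf j` of pairwise disjoint coupled pairs `{k, l} ⊆ B_j`, `k ≠ l`, without a common
neighbour and with link weight `β_{kl} = β₀`; `0 ≤ c ≤ |T| + 1`; `g_n` the cone-localized site terms of
the effective action.  Then, with `I_j = {n : nball N (m+1) n ∩ B_j ≠ ∅}`,
`Σ_j log(1 + (max 0 ((c⁴/8)·|Pf j|·32κ⁴β₀⁴/((d−1)d²(d+2)) − 4(|I_j|(4|κ|³υ³/(d−1)²)c³)²))/(2 + 2|I_j|(κ²υ²/(d−1))c²))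
 − |Λ|·(12κ²υ²/(d−1))c²·2e^{Kc}(Kc)^{m+1}/(m+1)! ≤ KL((Φ_{0→c})_*π̄ ‖ π̄.tilted(−cS))`. -/
theorem sum_log_one_add_explicit_sub_le_klDiv_map_loFlow (hU0 : ∀ n, U n n = 0)
    (hUadj : ∀ m n (v w : E), ⟪U m n v, w⟫ = ⟪v, U n m w⟫) (hd : 2 ≤ Module.finrank ℝ E)
    (κ S₀ : ℝ) {υ : ℝ} (hυ : ∀ k, ∑ m, ‖U k m‖ ≤ υ) {c : ℝ} (hc0 : 0 ≤ c) (hc : c ≤ |T| + 1)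
    {e : Λ → E} (he : ∀ n, ‖e n‖ = 1) (m : ℕ)
    {g : Λ → (Λ → sphere (0 : E) 1) → ℝ}
    (hg : ∀ n ω, g n ω = -∫ u in (0 : ℝ)..c, u * (2 * κ ^ 2 / ((Module.finrank ℝ E : ℝ) - 1) *
      ‖tangentKick (localField U n (sphereTDFlow (G := fun _ : ℝ => loFlowAction κ S₀ U)
          (contDiff_const_family (contDiff_loFlowAction U κ S₀)) T 0 u
          ((nball (fun k => insert k (couplingNbhd U k)) (m + 1) n).piecewise
            (fun i => ((ω i : sphere (0 : E) 1) : E)) e)))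
        (sphereTDFlow (G := fun _ : ℝ => loFlowAction κ S₀ U)
          (contDiff_const_family (contDiff_loFlowAction U κ S₀)) T 0 u
          ((nball (fun k => insert k (couplingNbhd U k)) (m + 1) n).piecewise
            (fun i => ((ω i : sphere (0 : E) 1) : E)) e) n)‖ ^ 2))
    {J : Type*} (Tb : Finset J) (B : J → Finset Λ)
    (hB : ∀ j ∈ Tb, ∀ j' ∈ Tb, j ≠ j' → Disjoint (B j) (B j'))
    (hsep : ∀ n, ∀ j ∈ Tb, ∀ j' ∈ Tb,
      ¬ Disjoint (nball (fun k => insert k (couplingNbhd U k)) (m + 1) n) ↑(B j) →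
      ¬ Disjoint (nball (fun k => insert k (couplingNbhd U k)) (m + 1) n) ↑(B j') → j = j')
    (Pf : J → Finset (Finset Λ))
    (hP : ∀ j ∈ Tb, ∀ P ∈ Pf j, ∀ P' ∈ Pf j, P ≠ P' → Disjoint P P')
    (hPC : ∀ j ∈ Tb, ∀ P ∈ Pf j, Disjoint P (Finset.univ \ Tb.biUnion B))
    {β : Λ → Λ → ℝ} (hβ : ∀ n m (v : E), ‖U n m v‖ = β n m * ‖v‖) {β₀ : ℝ}
    (hpair : ∀ j ∈ Tb, ∀ P ∈ Pf j, ∃ k l, P = {k, l} ∧ k ≠ l ∧ k ∈ B j ∧ l ∈ B j ∧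
      (∀ n, U n k = 0 ∨ U n l = 0) ∧ β k l = β₀) :
    ∑ j ∈ Tb, Real.log (1 + (max 0 (c ^ 4 / 8 * (((Pf j).card : ℝ) * (32 * κ ^ 4 * β₀ ^ 4 /
          (((Module.finrank ℝ E : ℝ) - 1) * (Module.finrank ℝ E : ℝ) ^ 2 * ((Module.finrank ℝ E : ℝ) + 2)))) -
        4 * ((Finset.univ.filter (fun n =>
            ¬ Disjoint (nball (fun k => insert k (couplingNbhd U k)) (m + 1) n) ↑(B j))).card *
          (4 * |κ| ^ 3 * υ ^ 3 / ((Module.finrank ℝ E : ℝ) - 1) ^ 2 * c ^ 3)) ^ 2)) /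
        (2 + 2 * ((Finset.univ.filter (fun n =>
            ¬ Disjoint (nball (fun k => insert k (couplingNbhd U k)) (m + 1) n) ↑(B j))).card *
          (κ ^ 2 * υ ^ 2 / ((Module.finrank ℝ E : ℝ) - 1) * c ^ 2)))) -
      Fintype.card Λ * (12 * κ ^ 2 * υ ^ 2 / ((Module.finrank ℝ E : ℝ) - 1) * c ^ 2 *
        (2 * Real.exp (3 * |κ| * υ / ((Module.finrank ℝ E : ℝ) - 1) * c) *
          (3 * |κ| * υ / ((Module.finrank ℝ E : ℝ) - 1) * c) ^ (m + 1) / ((m + 1)! : ℝ))) ≤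
      (klDiv (Measure.map (sphereTDFlowMap (G := fun _ : ℝ => loFlowAction κ S₀ U)
          (contDiff_const_family (contDiff_loFlowAction U κ S₀)) T 0 c)
          (Measure.pi (fun _ : Λ => uniformSphere (volume : Measure E))))
        ((Measure.pi (fun _ : Λ => uniformSphere (volume : Measure E))).tilted
          fun ω => -(c * esAction κ S₀ U (fun m => (ω m : E))))).toReal := by
  -- the per-pair conditional variance is the explicit constant
  have key : ∀ j ∈ Tb, ∑ P ∈ Pf j, ∫ ω,
          (coordAvg (uniformSphere (volume : Measure E)) (Finset.univ \ P)
            (fun ω => ∑ n ∈ Finset.univ.filter (fun n =>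
              ¬ Disjoint (nball (fun k => insert k (couplingNbhd U k)) (m + 1) n) ↑(B j)),
              2 * κ ^ 2 / ((Module.finrank ℝ E : ℝ) - 1) *
                ‖tangentKick (localField U n (fun i => ((ω i : sphere (0 : E) 1) : E))) (ω n : E)‖ ^ 2) ω -
          ∫ ω', (∑ n ∈ Finset.univ.filter (fun n =>
              ¬ Disjoint (nball (fun k => insert k (couplingNbhd U k)) (m + 1) n) ↑(B j)),
              2 * κ ^ 2 / ((Module.finrank ℝ E : ℝ) - 1) *
                ‖tangentKick (localField U n (fun i => ((ω' i : sphere (0 : E) 1) : E))) (ω' n : E)‖ ^ 2)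
            ∂Measure.pi (fun _ : Λ => uniformSphere (volume : Measure E))) ^ 2
          ∂Measure.pi (fun _ : Λ => uniformSphere (volume : Measure E)) =
      ((Pf j).card : ℝ) * (32 * κ ^ 4 * β₀ ^ 4 /
          (((Module.finrank ℝ E : ℝ) - 1) * (Module.finrank ℝ E : ℝ) ^ 2 * ((Module.finrank ℝ E : ℝ) + 2))) := by
    intro j hj
    rw [Finset.sum_eq_card_nsmul (b := 32 * κ ^ 4 * β₀ ^ 4 /
          (((Module.finrank ℝ E : ℝ) - 1) * (Module.finrank ℝ E : ℝ) ^ 2 * ((Module.finrank ℝ E : ℝ) + 2)))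
        fun P hPj => ?_, nsmul_eq_mul]
    obtain ⟨k, l, hPkl, hkl, hkB, hlB, htri, hβkl⟩ := hpair j hj P hPj
    subst hPkl
    have hmemI : ∀ {q : Λ}, q ∈ B j → q ∈ Finset.univ.filter (fun n =>
        ¬ Disjoint (nball (fun k => insert k (couplingNbhd U k)) (m + 1) n) ↑(B j)) := by
      intro q hq
      simp only [Finset.mem_filter, Finset.mem_univ, true_and, Set.not_disjoint_iff]
      exact ⟨q, self_mem_nball (m + 1) q, hq⟩
    rw [← hβkl]
    exact variance_coordAvg_pair_loCarreBlock_eq_of_isometric hd hU0 hUadj hβ hkl htri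
      (hmemI hkB) (hmemI hlB) κ
  refine le_trans (le_of_eq ?_)
    (sum_log_one_add_pairs_sub_le_klDiv_map_loFlow hU0 hUadj hd κ S₀ hυ hc0 hc he m hg Tb B hB hsep
      Pf hP hPC (T := T))
  congr 1
  exact Finset.sum_congr rfl fun j hj => by rw [key j hj]

end Explicit

section SmallTime

variable [MeasurableSpace E] [BorelSpace E] [Nontrivial E] {U : Λ → Λ → (E →L[ℝ] E)} {T : ℝ}

/-- **THE EXTENSIVE FLOOR AT SMALL FLOW TIME — LINEAR IN THE NUMBER OF BLOCKS.**  Hypotheses of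
`sum_log_one_add_explicit_sub_le_klDiv_map_loFlow` plus uniform block data (`n₀ ≤ |Pf j|`,
`|I_j| ≤ I₀`) and the three smallness conditions on `c`; conclusion
`|T_b|·n₀·A·c⁴/128 − |Λ|·(12κ²υ²/(d−1))c²·2e^{Kc}(Kc)^{m+1}/(m+1)! ≤ KL((Φ_{0→c})_*π̄ ‖ π̄.tilted(−cS))`,
`A = 32κ⁴β₀⁴/((d−1)d²(d+2))`. -/
theorem card_mul_pow_four_sub_le_klDiv_map_loFlow (hU0 : ∀ n, U n n = 0)
    (hUadj : ∀ m n (v w : E), ⟪U m n v, w⟫ = ⟪v, U n m w⟫) (hd : 2 ≤ Module.finrank ℝ E)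
    (κ S₀ : ℝ) {υ : ℝ} (hυ : ∀ k, ∑ m, ‖U k m‖ ≤ υ) {c : ℝ} (hc0 : 0 ≤ c) (hc : c ≤ |T| + 1)
    {e : Λ → E} (he : ∀ n, ‖e n‖ = 1) (m : ℕ)
    {g : Λ → (Λ → sphere (0 : E) 1) → ℝ}
    (hg : ∀ n ω, g n ω = -∫ u in (0 : ℝ)..c, u * (2 * κ ^ 2 / ((Module.finrank ℝ E : ℝ) - 1) *
      ‖tangentKick (localField U n (sphereTDFlow (G := fun _ : ℝ => loFlowAction κ S₀ U)
          (contDiff_const_family (contDiff_loFlowAction U κ S₀)) T 0 u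
          ((nball (fun k => insert k (couplingNbhd U k)) (m + 1) n).piecewise
            (fun i => ((ω i : sphere (0 : E) 1) : E)) e)))
        (sphereTDFlow (G := fun _ : ℝ => loFlowAction κ S₀ U)
          (contDiff_const_family (contDiff_loFlowAction U κ S₀)) T 0 u
          ((nball (fun k => insert k (couplingNbhd U k)) (m + 1) n).piecewise
            (fun i => ((ω i : sphere (0 : E) 1) : E)) e) n)‖ ^ 2))
    {J : Type*} (Tb : Finset J) (B : J → Finset Λ)
    (hB : ∀ j ∈ Tb, ∀ j' ∈ Tb, j ≠ j' → Disjoint (B j) (B j'))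
    (hsep : ∀ n, ∀ j ∈ Tb, ∀ j' ∈ Tb,
      ¬ Disjoint (nball (fun k => insert k (couplingNbhd U k)) (m + 1) n) ↑(B j) →
      ¬ Disjoint (nball (fun k => insert k (couplingNbhd U k)) (m + 1) n) ↑(B j') → j = j')
    (Pf : J → Finset (Finset Λ))
    (hP : ∀ j ∈ Tb, ∀ P ∈ Pf j, ∀ P' ∈ Pf j, P ≠ P' → Disjoint P P')
    (hPC : ∀ j ∈ Tb, ∀ P ∈ Pf j, Disjoint P (Finset.univ \ Tb.biUnion B))
    {β : Λ → Λ → ℝ} (hβ : ∀ n m (v : E), ‖U n m v‖ = β n m * ‖v‖) {β₀ : ℝ}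
    (hpair : ∀ j ∈ Tb, ∀ P ∈ Pf j, ∃ k l, P = {k, l} ∧ k ≠ l ∧ k ∈ B j ∧ l ∈ B j ∧
      (∀ n, U n k = 0 ∨ U n l = 0) ∧ β k l = β₀)
    {n₀ I₀ : ℝ} (hn0 : 0 ≤ n₀) (hn : ∀ j ∈ Tb, n₀ ≤ ((Pf j).card : ℝ))
    (hI : ∀ j ∈ Tb, ((Finset.univ.filter (fun n =>
            ¬ Disjoint (nball (fun k => insert k (couplingNbhd U k)) (m + 1) n) ↑(B j))).card : ℝ) ≤ I₀)
    (hc1 : 4 * I₀ ^ 2 * (4 * |κ| ^ 3 * υ ^ 3 / ((Module.finrank ℝ E : ℝ) - 1) ^ 2) ^ 2 * c ^ 2 ≤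
      n₀ * (32 * κ ^ 4 * β₀ ^ 4 /
        (((Module.finrank ℝ E : ℝ) - 1) * (Module.finrank ℝ E : ℝ) ^ 2 * ((Module.finrank ℝ E : ℝ) + 2))) / 16)
    (hc2 : I₀ * (κ ^ 2 * υ ^ 2 / ((Module.finrank ℝ E : ℝ) - 1)) * c ^ 2 ≤ 1)
    (hc3 : n₀ * (32 * κ ^ 4 * β₀ ^ 4 /
        (((Module.finrank ℝ E : ℝ) - 1) * (Module.finrank ℝ E : ℝ) ^ 2 * ((Module.finrank ℝ E : ℝ) + 2))) *
      c ^ 4 ≤ 64) :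
    (Tb.card : ℝ) * (n₀ * (32 * κ ^ 4 * β₀ ^ 4 /
          (((Module.finrank ℝ E : ℝ) - 1) * (Module.finrank ℝ E : ℝ) ^ 2 * ((Module.finrank ℝ E : ℝ) + 2))) *
        c ^ 4 / 128) -
      Fintype.card Λ * (12 * κ ^ 2 * υ ^ 2 / ((Module.finrank ℝ E : ℝ) - 1) * c ^ 2 *
        (2 * Real.exp (3 * |κ| * υ / ((Module.finrank ℝ E : ℝ) - 1) * c) *
          (3 * |κ| * υ / ((Module.finrank ℝ E : ℝ) - 1) * c) ^ (m + 1) / ((m + 1)! : ℝ))) ≤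
      (klDiv (Measure.map (sphereTDFlowMap (G := fun _ : ℝ => loFlowAction κ S₀ U)
          (contDiff_const_family (contDiff_loFlowAction U κ S₀)) T 0 c)
          (Measure.pi (fun _ : Λ => uniformSphere (volume : Measure E))))
        ((Measure.pi (fun _ : Λ => uniformSphere (volume : Measure E))).tilted
          fun ω => -(c * esAction κ S₀ U (fun m => (ω m : E))))).toReal := by
  have hd0 : (0 : ℝ) < (Module.finrank ℝ E : ℝ) := by exact_mod_cast Module.finrank_pos
  have hd1 : (0 : ℝ) < (Module.finrank ℝ E : ℝ) - 1 := by
    have : (2 : ℝ) ≤ Module.finrank ℝ E := by exact_mod_cast hd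
    linarith
  have hA : 0 ≤ 32 * κ ^ 4 * β₀ ^ 4 /
      (((Module.finrank ℝ E : ℝ) - 1) * (Module.finrank ℝ E : ℝ) ^ 2 * ((Module.finrank ℝ E : ℝ) + 2)) := by
    positivity
  have hμ : 0 ≤ κ ^ 2 * υ ^ 2 / ((Module.finrank ℝ E : ℝ) - 1) := by positivity
  have hblocks := card_mul_le_sum_blockTerm_of_small_time Tb
    (nn := fun j => ((Pf j).card : ℝ))
    (II := fun j => ((Finset.univ.filter (fun n =>
      ¬ Disjoint (nball (fun k => insert k (couplingNbhd U k)) (m + 1) n) ↑(B j))).card : ℝ))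
    (A := 32 * κ ^ 4 * β₀ ^ 4 /
      (((Module.finrank ℝ E : ℝ) - 1) * (Module.finrank ℝ E : ℝ) ^ 2 * ((Module.finrank ℝ E : ℝ) + 2)))
    (ρ := 4 * |κ| ^ 3 * υ ^ 3 / ((Module.finrank ℝ E : ℝ) - 1) ^ 2)
    (μ := κ ^ 2 * υ ^ 2 / ((Module.finrank ℝ E : ℝ) - 1)) (c := c)
    hn0 hA hμ hn (fun j _ => by positivity) hI hc1 hc2 hc3
  refine le_trans ?_ (sum_log_one_add_explicit_sub_le_klDiv_map_loFlow hU0 hUadj hd κ S₀ hυ hc0 hc he m hg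
    Tb B hB hsep Pf hP hPC hβ hpair (T := T))
  exact sub_le_sub_right hblocks _

end SmallTime

end Summit.Ventures.LatticeQCDFlow.Exactness

end
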